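import Literature.NumberTheory.Irrationality.Zudilin2014.FirstTale

/-!
# Zudilin 2014, second hypergeometric tale: the forms `q̂ ζ(2) − p̂` (Proposition 3) and Lemma 8 for `q̂`

Topic `Literature/NumberTheory/Irrationality/Zudilin2014` [Zudilin2014ZetaTwo, Section 6].  For integer parameters
`â = (â₀; â₁, â₂, â₃)`, `b̂ = (b̂₀; b̂₁, b̂₂, b̂₃)` (eq. (cond2)) the rational function
`R̂(t) = (2t+b̂₀)⋯(2t+â₀−1)/(â₀−b̂₀)! · (t+b̂₁)⋯(t+â₁−1)/(â₁−b̂₁)! · (b̂₂−â₂−1)!/((t+â₂)⋯(t+b̂₂−1)) ·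
(b̂₃−â₃−1)!/((t+â₃)⋯(t+b̂₃−1))` has the decomposition `R̂(t) = Σ_k A_k/(t+k)² + Σ_k B_k/(t+k)` with (eq. (T2))
`A_k = (R̂(t)(t+k)²)|_{t=−k} = (−1)^{d̂} binom(2k−b̂₀, 2k−â₀) binom(k−b̂₁, k−â₁) binom(b̂₂−â₂−1, k−â₂) binom(b̂₃−â₃−1, k−â₃)`,
`d̂ = b̂₂+b̂₃`, `B_k = d/dt (R̂(t)(t+k)²)|_{t=−k}`, and Proposition 3 writes the integral `r̂(â,b̂)` as `q̂ ζ(2) − p̂` with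
(proof of Prop. 3) `q̂ = (−1)^{d̂} Σ_{k=â₃*}^{b̂₂*−1} A_k`,
`p̂ = (−1)^{d̂} [ Σ_{k=â₃*}^{b̂₂*−1} 2A_k Σ_{ℓ=1}^{2k−â₀*} (−1)^{ℓ−1}/ℓ² + Σ_{k=â₂*}^{b̂₃*−1} B_k Σ_{ℓ=1}^{2k−â₀*} (−1)^{ℓ−1}/ℓ ]`,
`â₀* = min{â₀, 2â₂*}` (`â₁* ≤ â₂* ≤ â₃*` the ordered `â₁,â₂,â₃`, `b̂₂* ≤ b̂₃*`).

TYPED here (indices: `a 0..3 = â₀..â₃`, `b 0..3 = b̂₀..b̂₃`): `numT/denT/RT` (`R̂`), `multT` (pole order), `dhatT`,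
`qpolyT = num·(X+k)^{2−mult}`, `coefAT k = A_k`, `coefBT k = B_k` (value and derivative of `R̂(t)(t+k)²` at `−k` in
cover-up form), `aMid = â₂*`, `aMax3 = â₃*`, `bMin/bMax = b̂₂*/b̂₃*`, `a0star = â₀*`, `harmAlt1/2`, `formQT = q̂`,
`formPT = p̂`.  PROVED: the closed form (T2) of `A_k` on the double-pole range (`coefAT_eq_cast`, integer mirror
`coefATZ`), `q̂ ∈ ℤ` (`formQT_eq_cast`), and **Lemma 8 for `q̂`, termwise** [cite: Zudilin2014ZetaTwo, Lemma 8 and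
eq. (T3a)]: `p^e ∣ A_k` whenever `e ≤` the first-digit count
`(⌊(2k−b̂₀)/p⌋−⌊(2k−â₀)/p⌋−⌊(â₀−b̂₀)/p⌋) + (⌊(k−b̂₁)/p⌋−⌊(k−â₁)/p⌋−⌊(â₁−b̂₁)/p⌋) + Σ_{j=2,3}(⌊(b̂_j−â_j−1)/p⌋−⌊(k−â_j)/p⌋−⌊(b̂_j−1−k)/p⌋)`
(`pow_dvd_coefATZ`, from Kummer's first carry `firstDigit_le_padicValNat_choose`), hence `p^e ∣ q̂` when this holds
for every `k` of the range (`pow_dvd_formQTZ`).  The `B_k`/`p̂` half of Lemma 8 is the companion file's.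
The analytic identity `r̂ = q̂ ζ(2) − p̂` is NOT formalised (the forms are DEFINED by the printed closed formulas).

Cell pub-zeta5 (HONEST FRAMING: systematic search; no irrationality claim unless certified).
-/

noncomputable section

open Polynomial Finset

namespace Literature.NumberTheory.Irrationality.Zudilin2014

/-! ### Parameters (eq. (cond2)) and the rational function `R̂` -/

/-- **Admissible second-tale parameters** [cite: Zudilin2014ZetaTwo, Section 6, eq. (cond2)]:
`½b̂₀, b̂₁ ≤ ½â₀, â₁, â₂, â₃ < b̂₂, b̂₃` and `Σ â = Σ b̂ − 2`. -/
structure AdmissibleT (a b : Fin 4 → ℤ) : Prop where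
  /-- `b̂₀ ≤ â₀` -/
  b0_le_a0 : b 0 ≤ a 0
  /-- `b̂₀ ≤ 2 â_j`, `j = 1,2,3` -/
  b0_le : ∀ j : Fin 4, j ≠ 0 → b 0 ≤ 2 * a j
  /-- `2 b̂₁ ≤ â₀` -/
  b1_le_a0 : 2 * b 1 ≤ a 0
  /-- `b̂₁ ≤ â_j`, `j = 1,2,3` -/
  b1_le : ∀ j : Fin 4, j ≠ 0 → b 1 ≤ a j
  /-- `â₀ < 2 b̂₂, 2 b̂₃` -/
  a0_lt : a 0 < 2 * b 2 ∧ a 0 < 2 * b 3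
  /-- `â_j < b̂₂, b̂₃`, `j = 1,2,3` -/
  a_lt : ∀ j : Fin 4, j ≠ 0 → a j < b 2 ∧ a j < b 3
  /-- `Σ â = Σ b̂ − 2` -/
  balance : (∑ i, a i) + 2 = ∑ i, b i

/-- The doubled block `∏_{lo ≤ ℓ < hi} (2X + ℓ)`. [cite: Zudilin2014ZetaTwo, Section 6 (definition of R̂)] -/
def block2 (lo hi : ℤ) : ℚ[X] := ∏ l ∈ Ico lo hi, (C (2 : ℚ) * X + C (l : ℚ))

/-- The normalisation `(b̂₂−â₂−1)!(b̂₃−â₃−1)!/((â₀−b̂₀)!(â₁−b̂₁)!)` (`= Π̂(â,b̂)`).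
[cite: Zudilin2014ZetaTwo, Section 6 (definition of R̂)] -/
def normT (a b : Fin 4 → ℤ) : ℚ := facZ (b 2 - a 2 - 1) * facZ (b 3 - a 3 - 1) / (facZ (a 0 - b 0) * facZ (a 1 - b 1))

/-- The numerator of `R̂`: `Π̂ · (2t+b̂₀)⋯(2t+â₀−1) · (t+b̂₁)⋯(t+â₁−1)`.
[cite: Zudilin2014ZetaTwo, Section 6 (definition of R̂)] -/
def numT (a b : Fin 4 → ℤ) : ℚ[X] := C (normT a b) * (block2 (b 0) (a 0) * block (b 1) (a 1))

/-- The denominator `(t+â₂)⋯(t+b̂₂−1)·(t+â₃)⋯(t+b̂₃−1)` of `R̂`. [cite: Zudilin2014ZetaTwo, Section 6 (definition of R̂)] -/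
def denT (a b : Fin 4 → ℤ) : ℚ[X] := block (a 2) (b 2) * block (a 3) (b 3)

/-- **`R̂(â,b̂;t)`** as a function on `ℚ` (off the poles). [cite: Zudilin2014ZetaTwo, Section 6 (definition of R̂)] -/
def RT (a b : Fin 4 → ℤ) (t : ℚ) : ℚ := (numT a b).eval t / (denT a b).eval t

/-- The order of the pole of `R̂`'s denominator at `t = −k` (`0,1,2`). [cite: Zudilin2014ZetaTwo, Section 6 (poles of R̂)] -/
def multT (a b : Fin 4 → ℤ) (k : ℤ) : ℕ :=
  (if k ∈ Ico (a 2) (b 2) then 1 else 0) + (if k ∈ Ico (a 3) (b 3) then 1 else 0)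

/-- The denominator with the factors `(X+k)` removed. [cite: Zudilin2014ZetaTwo, Section 6, eq. (T2)] -/
def dhatT (a b : Fin 4 → ℤ) (k : ℤ) : ℚ[X] :=
  (∏ i ∈ (Ico (a 2) (b 2)).erase k, (X + C (i : ℚ))) * ∏ i ∈ (Ico (a 3) (b 3)).erase k, (X + C (i : ℚ))

/-- `num·(X+k)^{2−mult}`, so that `R̂(t)(t+k)² = qpolyT(t)/dhatT(t)`. [cite: Zudilin2014ZetaTwo, Section 6, eq. (T2)] -/
def qpolyT (a b : Fin 4 → ℤ) (k : ℤ) : ℚ[X] := numT a b * (X + C (k : ℚ)) ^ (2 - multT a b k)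

/-- **`A_k = (R̂(t)(t+k)²)|_{t=−k}`** [cite: Zudilin2014ZetaTwo, Section 6, eq. (T2)]. -/
def coefAT (a b : Fin 4 → ℤ) (k : ℤ) : ℚ := (qpolyT a b k).eval (-(k : ℚ)) / (dhatT a b k).eval (-(k : ℚ))

/-- **`B_k = d/dt (R̂(t)(t+k)²)|_{t=−k}`** (quotient rule on `qpolyT/dhatT`) [cite: Zudilin2014ZetaTwo, Section 6, after
eq. (T2)]. -/
def coefBT (a b : Fin 4 → ℤ) (k : ℤ) : ℚ :=
  ((derivative (qpolyT a b k)).eval (-(k : ℚ)) * (dhatT a b k).eval (-(k : ℚ))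
    - (qpolyT a b k).eval (-(k : ℚ)) * (derivative (dhatT a b k)).eval (-(k : ℚ)))
    / (dhatT a b k).eval (-(k : ℚ)) ^ 2

/-- `â₂*`, the median of `â₁, â₂, â₃`. [cite: Zudilin2014ZetaTwo, Section 6 (ordered parameters)] -/
def aMid (a : Fin 4 → ℤ) : ℤ := max (min (a 1) (a 2)) (min (max (a 1) (a 2)) (a 3))

/-- `â₃* = max(â₁, â₂, â₃)`. [cite: Zudilin2014ZetaTwo, Section 6 (ordered parameters)] -/
def aMax3 (a : Fin 4 → ℤ) : ℤ := max (a 1) (max (a 2) (a 3))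

/-- `b̂₂* = min(b̂₂, b̂₃)`. [cite: Zudilin2014ZetaTwo, Section 6 (ordered parameters)] -/
def bMin (b : Fin 4 → ℤ) : ℤ := min (b 2) (b 3)

/-- `b̂₃* = max(b̂₂, b̂₃)`. [cite: Zudilin2014ZetaTwo, Section 6 (ordered parameters)] -/
def bMax (b : Fin 4 → ℤ) : ℤ := max (b 2) (b 3)

/-- `â₀* = min{â₀, 2â₂*}`. [cite: Zudilin2014ZetaTwo, Section 6 (zeroes of R̂)] -/
def a0star (a : Fin 4 → ℤ) : ℤ := min (a 0) (2 * aMid a)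

/-- The sign `(−1)^{d̂}`, `d̂ = b̂₂ + b̂₃`. [cite: Zudilin2014ZetaTwo, Section 6, eq. (T2)] -/
def signT (b : Fin 4 → ℤ) : ℚ := (-1) ^ (b 2 + b 3).natAbs

/-- `Σ_{ℓ=1}^{m} (−1)^{ℓ−1}/ℓ²`. [cite: Zudilin2014ZetaTwo, proof of Proposition 3] -/
def harmAlt2 (m : ℕ) : ℚ := ∑ l ∈ range m, (-1) ^ l / ((l + 1 : ℚ) ^ 2)

/-- `Σ_{ℓ=1}^{m} (−1)^{ℓ−1}/ℓ`. [cite: Zudilin2014ZetaTwo, proof of Proposition 3] -/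
def harmAlt1 (m : ℕ) : ℚ := ∑ l ∈ range m, (-1) ^ l / (l + 1 : ℚ)

/-- **`q̂(â,b̂) = (−1)^{d̂} Σ_{k=â₃*}^{b̂₂*−1} A_k`** [cite: Zudilin2014ZetaTwo, Proposition 3 and Remark 5]. -/
def formQT (a b : Fin 4 → ℤ) : ℚ := signT b * ∑ k ∈ Ico (aMax3 a) (bMin b), coefAT a b k

/-- **`p̂(â,b̂)`** [cite: Zudilin2014ZetaTwo, proof of Proposition 3]:
`(−1)^{d̂} [ Σ_{k=â₃*}^{b̂₂*−1} 2A_k Σ_{ℓ≤2k−â₀*} (−1)^{ℓ−1}/ℓ² + Σ_{k=â₂*}^{b̂₃*−1} B_k Σ_{ℓ≤2k−â₀*} (−1)^{ℓ−1}/ℓ ]`. -/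
def formPT (a b : Fin 4 → ℤ) : ℚ :=
  signT b * (∑ k ∈ Ico (aMax3 a) (bMin b), 2 * coefAT a b k * harmAlt2 (2 * k - a0star a).toNat
    + ∑ k ∈ Ico (aMid a) (bMax b), coefBT a b k * harmAlt1 (2 * k - a0star a).toNat)

/-! ### Products over blocks at integers -/

/-- Descending product: for `lo ≤ hi ≤ k`, `∏_{lo≤i<hi} (i − k) = (−1)^{hi−lo} · (k−lo)(k−lo−1)⋯(k−hi+1)`
`= (−1)^{m} m! binom(k−lo, m)`, `m = hi − lo`. [cite: Zudilin2014ZetaTwo, Section 6, eq. (T2) (evaluation of the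
blocks at the poles)] -/
theorem prod_Ico_sub_eq (lo hi k : ℤ) (hlh : lo ≤ hi) (hk : hi ≤ k) :
    ∏ i ∈ Ico lo hi, ((i : ℚ) - k) =
      (-1) ^ (hi - lo).toNat * (((hi - lo).toNat.factorial : ℕ) : ℚ) *
        ((Nat.choose (k - lo).toNat (hi - lo).toNat : ℕ) : ℚ) := by
  set m := (hi - lo).toNat with hm
  set K := (k - lo).toNat with hK
  have himage : Ico lo hi = (range m).image fun j : ℕ => lo + j := by
    ext i; simp only [mem_Ico, mem_image, mem_range]
    constructor
    · rintro ⟨h1, h2⟩; exact ⟨(i - lo).toNat, by omega, by omega⟩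
    · rintro ⟨j, hj, rfl⟩; omega
  have hinj : Set.InjOn (fun j : ℕ => lo + (j : ℤ)) (range m : Finset ℕ) := by
    intro x _ y _ hxy; have : (x : ℤ) = y := by dsimp at hxy; linarith
    exact_mod_cast this
  rw [himage, prod_image hinj]
  have e : ∀ j ∈ range m, (((lo + (j : ℤ) : ℤ) : ℚ) - k) = (-1) * (((K - j : ℕ) : ℚ)) := by
    intro j hj
    have hj' := mem_range.1 hj
    have hKz : (K : ℤ) = k - lo := by rw [hK]; omega
    have hKq : ((K : ℕ) : ℚ) = (k : ℚ) - lo := by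
      have := congrArg (fun z : ℤ => (z : ℚ)) hKz; push_cast at this; exact this
    have hjK : j ≤ K := by omega
    rw [Nat.cast_sub hjK, hKq]; push_cast; ring
  rw [prod_congr rfl e, prod_mul_distrib, prod_const, card_range, ← Nat.cast_prod,
    ← Nat.descFactorial_eq_prod_range, Nat.descFactorial_eq_factorial_mul_choose]
  push_cast; ring

/-- Ascending product: `∏_{k < i < b} (i − k) = (b−1−k)!`. [cite: Zudilin2014ZetaTwo, Section 6, eq. (T2)] -/
theorem prod_Ico_succ_sub_eq (k b : ℤ) (hkb : k < b) :
    ∏ i ∈ Ico (k + 1) b, ((i : ℚ) - k) = (((b - 1 - k).toNat.factorial : ℕ) : ℚ) := by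
  set m := (b - 1 - k).toNat with hm
  have himage : Ico (k + 1) b = (range m).image fun j : ℕ => k + 1 + j := by
    ext i; simp only [mem_Ico, mem_image, mem_range]
    constructor
    · rintro ⟨h1, h2⟩; exact ⟨(i - k - 1).toNat, by omega, by omega⟩
    · rintro ⟨j, hj, rfl⟩; omega
  have hinj : Set.InjOn (fun j : ℕ => k + 1 + (j : ℤ)) (range m : Finset ℕ) := by
    intro x _ y _ hxy; have : (x : ℤ) = y := by dsimp at hxy; linarith
    exact_mod_cast this
  rw [himage, prod_image hinj, ← Finset.prod_range_add_one_eq_factorial, Nat.cast_prod]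
  refine prod_congr rfl fun j _ => ?_
  push_cast; ring

/-- The cover-up denominator of one block: for `a ≤ k < b`,
`∏_{i ∈ [a,b), i ≠ k} (i − k) = (−1)^{k−a} (k−a)! (b−1−k)!`. [cite: Zudilin2014ZetaTwo, Section 6, eq. (T2)] -/
theorem prod_erase_sub_eq {a b k : ℤ} (hk : k ∈ Ico a b) :
    ∏ i ∈ (Ico a b).erase k, ((i : ℚ) - k) =
      (-1) ^ (k - a).toNat * (((k - a).toNat.factorial : ℕ) : ℚ) * (((b - 1 - k).toNat.factorial : ℕ) : ℚ) := by
  have hk' := mem_Ico.1 hk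
  have hsplit : (Ico a b).erase k = Ico a k ∪ Ico (k + 1) b := by
    ext i; simp only [mem_erase, mem_Ico, mem_union]; omega
  have hdisj : Disjoint (Ico a k) (Ico (k + 1) b) := by
    rw [disjoint_left]; intro i h1 h2; rw [mem_Ico] at h1 h2; omega
  rw [hsplit, prod_union hdisj, prod_Ico_sub_eq a k k hk'.1 le_rfl, prod_Ico_succ_sub_eq k b hk'.2]
  simp

/-! ### The closed form (T2) of `A_k` -/

/-- The integer mirror of `A_k` (eq. (T2)): `0` if `2k < â₀` (a numerator zero), else
`(−1)^{(â₀−b̂₀)+(â₁−b̂₁)+(k−â₂)+(k−â₃)} binom(2k−b̂₀, â₀−b̂₀) binom(k−b̂₁, â₁−b̂₁) binom(b̂₂−â₂−1, k−â₂) binom(b̂₃−â₃−1, k−â₃)`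
(`binom(2k−b̂₀, â₀−b̂₀) = binom(2k−b̂₀, 2k−â₀)`; the sign equals `(−1)^{d̂}` by `Σâ = Σb̂ − 2`).
[cite: Zudilin2014ZetaTwo, Section 6, eq. (T2)] -/
def coefATZ (a b : Fin 4 → ℤ) (k : ℤ) : ℤ :=
  if 2 * k < a 0 then 0 else
    (-1) ^ ((a 0 - b 0).toNat + (a 1 - b 1).toNat + (k - a 2).toNat + (k - a 3).toNat)
      * (Nat.choose (2 * k - b 0).toNat (a 0 - b 0).toNat : ℤ) * (Nat.choose (k - b 1).toNat (a 1 - b 1).toNat : ℤ)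
      * (Nat.choose (b 2 - a 2 - 1).toNat (k - a 2).toNat : ℤ) * (Nat.choose (b 3 - a 3 - 1).toNat (k - a 3).toNat : ℤ)

/-- Evaluation of the doubled block at `−k`: `∏ (2(−k) + ℓ) = ∏_{ℓ} (ℓ − 2k)`. [cite: Zudilin2014ZetaTwo, Section 6] -/
theorem eval_block2 (lo hi : ℤ) (t : ℚ) : (block2 lo hi).eval t = ∏ l ∈ Ico lo hi, (2 * t + l) := by
  unfold block2; rw [eval_prod]; simp

/-- On the double-pole range `k ∈ [â₂, b̂₂) ∩ [â₃, b̂₃)`, `multT = 2` and `qpolyT = numT`.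
[cite: Zudilin2014ZetaTwo, Section 6 (double poles of R̂)] -/
theorem qpolyT_eq_of_double {a b : Fin 4 → ℤ} {k : ℤ} (h2 : k ∈ Ico (a 2) (b 2)) (h3 : k ∈ Ico (a 3) (b 3)) :
    qpolyT a b k = numT a b := by
  unfold qpolyT multT; rw [if_pos h2, if_pos h3]; simp

/-- `dhatT(−k)` on the double-pole range. [cite: Zudilin2014ZetaTwo, Section 6, eq. (T2)] -/
theorem eval_dhatT_of_double {a b : Fin 4 → ℤ} {k : ℤ} (h2 : k ∈ Ico (a 2) (b 2)) (h3 : k ∈ Ico (a 3) (b 3)) :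
    (dhatT a b k).eval (-(k : ℚ)) =
      ((-1) ^ (k - a 2).toNat * (((k - a 2).toNat.factorial : ℕ) : ℚ) * (((b 2 - 1 - k).toNat.factorial : ℕ) : ℚ))
        * ((-1) ^ (k - a 3).toNat * (((k - a 3).toNat.factorial : ℕ) : ℚ)
          * (((b 3 - 1 - k).toNat.factorial : ℕ) : ℚ)) := by
  unfold dhatT
  rw [eval_mul, eval_prod, eval_prod]
  have e : ∀ (s : Finset ℤ), ∏ i ∈ s, ((X + C (i : ℚ)).eval (-(k : ℚ))) = ∏ i ∈ s, ((i : ℚ) - k) := fun s =>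
    prod_congr rfl fun i _ => by simp; ring
  rw [e, e, prod_erase_sub_eq h2, prod_erase_sub_eq h3]

/-- `dhatT(−k) ≠ 0` on the double-pole range. [cite: Zudilin2014ZetaTwo, Section 6, eq. (T2)] -/
theorem eval_dhatT_ne_zero {a b : Fin 4 → ℤ} {k : ℤ} (h2 : k ∈ Ico (a 2) (b 2)) (h3 : k ∈ Ico (a 3) (b 3)) :
    (dhatT a b k).eval (-(k : ℚ)) ≠ 0 := by
  rw [eval_dhatT_of_double h2 h3]
  have h := fun n : ℕ => (Nat.cast_ne_zero (R := ℚ)).2 (Nat.factorial_ne_zero n)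
  exact mul_ne_zero (mul_ne_zero (mul_ne_zero (pow_ne_zero _ (by norm_num)) (h _)) (h _))
    (mul_ne_zero (mul_ne_zero (pow_ne_zero _ (by norm_num)) (h _)) (h _))

/-- **Eq. (T2): the closed form of `A_k`** on the double-pole range, for `k ≥ â₁` and `2k ≥ b̂₀`:
`A_k = coefATZ k` [cite: Zudilin2014ZetaTwo, Section 6, eq. (T2)]. -/
theorem coefAT_eq_cast {a b : Fin 4 → ℤ} (hab : AdmissibleT a b) {k : ℤ} (h2 : k ∈ Ico (a 2) (b 2))
    (h3 : k ∈ Ico (a 3) (b 3)) (hk1 : a 1 ≤ k) (hk0 : b 0 ≤ 2 * k) :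
    coefAT a b k = (coefATZ a b k : ℚ) := by
  have hk2 := mem_Ico.1 h2
  have hk3 := mem_Ico.1 h3
  have hD := eval_dhatT_ne_zero h2 h3
  unfold coefAT
  rw [qpolyT_eq_of_double h2 h3, div_eq_iff hD, eval_dhatT_of_double h2 h3]
  unfold numT normT
  rw [eval_mul, eval_C, eval_mul, eval_block2, eval_block]
  -- the block `(t+b̂₁)⋯(t+â₁−1)` at `−k`
  have e1 : ∏ i ∈ Ico (b 1) (a 1), (-(k : ℚ) + i) = ∏ i ∈ Ico (b 1) (a 1), ((i : ℚ) - k) :=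
    prod_congr rfl fun i _ => by ring
  rw [e1, prod_Ico_sub_eq (b 1) (a 1) k (hab.b1_le 1 (by decide)) hk1]
  by_cases hz : 2 * k < a 0
  · -- a numerator zero: the factor `ℓ = 2k` of the doubled block vanishes
    have hmem : 2 * k ∈ Ico (b 0) (a 0) := mem_Ico.2 ⟨hk0, hz⟩
    have h0 : ∏ l ∈ Ico (b 0) (a 0), (2 * (-(k : ℚ)) + l) = 0 :=
      prod_eq_zero hmem (by push_cast; ring)
    rw [h0, coefATZ, if_pos hz]; simp
  · push Not at hz
    have e0 : ∏ l ∈ Ico (b 0) (a 0), (2 * (-(k : ℚ)) + l) = ∏ l ∈ Ico (b 0) (a 0), ((l : ℚ) - ((2 * k : ℤ) : ℚ)) :=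
      prod_congr rfl fun l _ => by push_cast; ring
    rw [e0, prod_Ico_sub_eq (b 0) (a 0) (2 * k) hab.b0_le_a0 hz, coefATZ, if_neg (not_lt.2 hz)]
    -- binomials times factorials
    have c2 := Nat.choose_mul_factorial_mul_factorial (show (k - a 2).toNat ≤ (b 2 - a 2 - 1).toNat by omega)
    have c3 := Nat.choose_mul_factorial_mul_factorial (show (k - a 3).toNat ≤ (b 3 - a 3 - 1).toNat by omega)
    have s2 : (b 2 - a 2 - 1).toNat - (k - a 2).toNat = (b 2 - 1 - k).toNat := by omega
    have s3 : (b 3 - a 3 - 1).toNat - (k - a 3).toNat = (b 3 - 1 - k).toNat := by omega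
    rw [s2] at c2; rw [s3] at c3
    have c2' : ((Nat.choose (b 2 - a 2 - 1).toNat (k - a 2).toNat : ℕ) : ℚ) * ((k - a 2).toNat.factorial : ℕ)
        * ((b 2 - 1 - k).toNat.factorial : ℕ) = ((b 2 - a 2 - 1).toNat.factorial : ℕ) := by exact_mod_cast c2
    have c3' : ((Nat.choose (b 3 - a 3 - 1).toNat (k - a 3).toNat : ℕ) : ℚ) * ((k - a 3).toNat.factorial : ℕ)
        * ((b 3 - 1 - k).toNat.factorial : ℕ) = ((b 3 - a 3 - 1).toNat.factorial : ℕ) := by exact_mod_cast c3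
    have hf0 : (((a 0 - b 0).toNat.factorial : ℕ) : ℚ) ≠ 0 := by positivity
    have hf1 : (((a 1 - b 1).toNat.factorial : ℕ) : ℚ) ≠ 0 := by positivity
    simp only [facZ, pow_add]
    push_cast
    rw [← c2', ← c3']
    rcases neg_one_pow_eq_or ℚ (k - a 2).toNat with h2s | h2s <;>
      rcases neg_one_pow_eq_or ℚ (k - a 3).toNat with h3s | h3s <;>
        simp only [h2s, h3s] <;> field_simp

/-! ### Lemma 8 for `q̂`: the termwise bound via Kummer's first carry -/

/-- The first base-`p` digit count `⌊M/p⌋ − ⌊m/p⌋ − ⌊(M−m)/p⌋ ∈ {0,1}` is at most `ord_p binom(M, m)`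
(Kummer: it is the carry out of the lowest digit). [cite: Zudilin2014ZetaTwo, Section 6, eq. (T3a)] -/
theorem firstDigit_le_padicValNat_choose {p : ℕ} [hp : Fact p.Prime] {M m : ℕ} (h : m ≤ M) :
    M / p - m / p - (M - m) / p ≤ padicValNat p (M.choose m) := by
  have hp0 : 0 < p := hp.out.pos
  have hsplit : M / p = m / p + (M - m) / p + if p ≤ m % p + (M - m) % p then 1 else 0 := by
    conv_lhs => rw [← Nat.add_sub_cancel' h]
    exact Nat.add_div hp0
  by_cases hc : p ≤ m % p + (M - m) % p
  · rw [if_pos hc] at hsplit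
    have h1 : M / p - m / p - (M - m) / p = 1 := by omega
    rw [h1]
    have hk := padicValNat_choose (p := p) h (Nat.lt_succ_self (Nat.log p M))
    rw [hk]
    refine Nat.one_le_iff_ne_zero.2 (Finset.card_ne_zero.2 ⟨1, ?_⟩)
    simp only [Finset.mem_filter, Finset.mem_Ico, le_refl, true_and, pow_one]
    refine ⟨?_, hc⟩
    have : 1 ≤ Nat.log p M := by
      apply Nat.le_log_of_pow_le hp.out.one_lt
      rw [pow_one]
      have := Nat.mod_lt m hp0; have := Nat.mod_lt (M - m) hp0
      have : m % p ≤ m := Nat.mod_le _ _; have : (M - m) % p ≤ M - m := Nat.mod_le _ _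
      omega
    omega
  · rw [if_neg hc] at hsplit
    have h0 : M / p - m / p - (M - m) / p = 0 := by omega
    rw [h0]; exact Nat.zero_le _

/-- Divisibility form: `p^{⌊M/p⌋ − ⌊m/p⌋ − ⌊(M−m)/p⌋} ∣ binom(M,m)` in `ℤ`. [cite: Zudilin2014ZetaTwo, Section 6, eq. (T3a)] -/
theorem pow_firstDigit_dvd_choose {p : ℕ} [hp : Fact p.Prime] {M m : ℕ} (h : m ≤ M) :
    (p : ℤ) ^ (M / p - m / p - (M - m) / p) ∣ (Nat.choose M m : ℤ) := by
  have hne : M.choose m ≠ 0 := Nat.choose_ne_zero h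
  have h1 : p ^ (M / p - m / p - (M - m) / p) ∣ M.choose m :=
    (pow_dvd_pow p (firstDigit_le_padicValNat_choose h)).trans pow_padicValNat_dvd
  exact_mod_cast h1

/-- The first-digit count of eq. (T3a) for `A_k` (double-pole range, `2k ≥ â₀`, `k ≥ â₁`), as a natural number:
`Σ` of the four carries of the binomials of (T2). [cite: Zudilin2014ZetaTwo, Section 6, eq. (T3a)] -/
def digitAT (p : ℕ) (a b : Fin 4 → ℤ) (k : ℤ) : ℕ :=
  ((2 * k - b 0).toNat / p - (a 0 - b 0).toNat / p - (2 * k - a 0).toNat / p)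
  + ((k - b 1).toNat / p - (a 1 - b 1).toNat / p - (k - a 1).toNat / p)
  + ((b 2 - a 2 - 1).toNat / p - (k - a 2).toNat / p - (b 2 - 1 - k).toNat / p)
  + ((b 3 - a 3 - 1).toNat / p - (k - a 3).toNat / p - (b 3 - 1 - k).toNat / p)

/-- **Lemma 8 for `A_k`** [cite: Zudilin2014ZetaTwo, Lemma 8 and eq. (T3a)]: on the double-pole range with `k ≥ â₁`,
`2k ≥ b̂₀`: `p^{digitAT} ∣ A_k` (when `2k < â₀`, `A_k = 0`). -/
theorem pow_dvd_coefATZ {p : ℕ} [hp : Fact p.Prime] {a b : Fin 4 → ℤ} {k : ℤ}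
    (h2 : k ∈ Ico (a 2) (b 2)) (h3 : k ∈ Ico (a 3) (b 3)) (hk1 : a 1 ≤ k) (hb0 : b 0 ≤ a 0) (hb1 : b 1 ≤ a 1) :
    (p : ℤ) ^ digitAT p a b k ∣ coefATZ a b k := by
  have hk2 := mem_Ico.1 h2
  have hk3 := mem_Ico.1 h3
  unfold coefATZ
  split_ifs with hz
  · exact dvd_zero _
  · push Not at hz
    unfold digitAT
    have d0 := pow_firstDigit_dvd_choose (p := p) (show (a 0 - b 0).toNat ≤ (2 * k - b 0).toNat by omega)
    have d1 := pow_firstDigit_dvd_choose (p := p) (show (a 1 - b 1).toNat ≤ (k - b 1).toNat by omega)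
    have d2 := pow_firstDigit_dvd_choose (p := p) (show (k - a 2).toNat ≤ (b 2 - a 2 - 1).toNat by omega)
    have d3 := pow_firstDigit_dvd_choose (p := p) (show (k - a 3).toNat ≤ (b 3 - a 3 - 1).toNat by omega)
    have e0 : (2 * k - b 0).toNat - (a 0 - b 0).toNat = (2 * k - a 0).toNat := by omega
    have e1 : (k - b 1).toNat - (a 1 - b 1).toNat = (k - a 1).toNat := by omega
    have e2 : (b 2 - a 2 - 1).toNat - (k - a 2).toNat = (b 2 - 1 - k).toNat := by omega
    have e3 : (b 3 - a 3 - 1).toNat - (k - a 3).toNat = (b 3 - 1 - k).toNat := by omega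
    rw [e0] at d0; rw [e1] at d1; rw [e2] at d2; rw [e3] at d3
    rw [pow_add, pow_add, pow_add]
    have h := mul_dvd_mul (mul_dvd_mul (mul_dvd_mul d0 d1) d2) d3
    exact h.trans (Dvd.intro_left ((-1 : ℤ) ^ ((a 0 - b 0).toNat + (a 1 - b 1).toNat + (k - a 2).toNat
      + (k - a 3).toNat)) (by ring))

/-- The integer mirror of `q̂`. [cite: Zudilin2014ZetaTwo, Proposition 3] -/
def formQTZ (a b : Fin 4 → ℤ) : ℤ := (-1) ^ (b 2 + b 3).natAbs * ∑ k ∈ Ico (aMax3 a) (bMin b), coefATZ a b k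

/-- The summation range `[â₃*, b̂₂*)` lies in the double-pole range and above `â₁`.
[cite: Zudilin2014ZetaTwo, Section 6 (ordered parameters)] -/
theorem mem_double_of_mem_range {a b : Fin 4 → ℤ} {k : ℤ} (hk : k ∈ Ico (aMax3 a) (bMin b)) :
    k ∈ Ico (a 2) (b 2) ∧ k ∈ Ico (a 3) (b 3) ∧ a 1 ≤ k := by
  simp only [mem_Ico, aMax3, bMin, max_le_iff, lt_min_iff] at hk ⊢
  omega

/-- **Proposition 3, `q̂ ∈ ℤ`** [cite: Zudilin2014ZetaTwo, Proposition 3]: `formQT = formQTZ` for admissible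
parameters. -/
theorem formQT_eq_cast {a b : Fin 4 → ℤ} (hab : AdmissibleT a b) : formQT a b = (formQTZ a b : ℚ) := by
  unfold formQT formQTZ signT
  push_cast
  congr 1
  refine sum_congr rfl fun k hk => ?_
  obtain ⟨h2, h3, h1⟩ := mem_double_of_mem_range hk
  have hb0 : b 0 ≤ 2 * k := (hab.b0_le 1 (by decide)).trans (by omega)
  exact coefAT_eq_cast hab h2 h3 h1 hb0

/-- **Lemma 8 for `q̂`, divisibility form** [cite: Zudilin2014ZetaTwo, Lemma 8]: if `e ≤ digitAT p k` for every `k`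
of the range `[â₃*, b̂₂*)` with `2k ≥ â₀`, then `p^e ∣ q̂`. -/
theorem pow_dvd_formQTZ {p : ℕ} [hp : Fact p.Prime] {a b : Fin 4 → ℤ} (hab : AdmissibleT a b) {e : ℕ}
    (he : ∀ k ∈ Ico (aMax3 a) (bMin b), a 0 ≤ 2 * k → e ≤ digitAT p a b k) :
    (p : ℤ) ^ e ∣ formQTZ a b := by
  unfold formQTZ
  refine Dvd.dvd.mul_left (dvd_sum fun k hk => ?_) _
  obtain ⟨h2, h3, h1⟩ := mem_double_of_mem_range hk
  by_cases hz : 2 * k < a 0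
  · have : coefATZ a b k = 0 := by unfold coefATZ; rw [if_pos hz]
    rw [this]; exact dvd_zero _
  · exact (pow_dvd_pow _ (he k hk (not_lt.1 hz))).trans
      (pow_dvd_coefATZ h2 h3 h1 hab.b0_le_a0 (hab.b1_le 1 (by decide)))

end Literature.NumberTheory.Irrationality.Zudilin2014

end
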